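import Summits.MatrixMultiplication.MatrixMultiplication.Theorems.OutsiderSandwichSliceConcise
import HarnessLib

/-!
# No catalysis: `⟨m+k⟩ ⊠ C₁^{⊠N} ⋭ ⟨m⟩ ⊠ ⟨2,2,2⟩^{⊠N} ⊕ ⟨k⟩ ⊠ C₁^{⊠N}`

Route `OutsiderSandwich` (decomposition cell `decomp-mm`, lens 4 «minimal counterexample /
extremal reduction», gen 28, addendum), support for the aside leaf `BlockOneIsMM`
(stmt-MatrixMultiplication-27147).

`OutsiderSandwichNoTightExchange.not_tight` showed that `m` coupled blocks never restrict to `m`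
matrix products.  A CATALYST could a priori still help: `m + k` coupled blocks might restrict to
`m` products while handing the other `k` blocks back intact — in the semiring
`m·[⟨2,2,2⟩]^N + k·[C₁]^N ≤ (m+k)·[C₁]^N` — and no spectral point can exclude this (spectrally it
reads `F⟨2,2,2⟩ ≤ F(C₁)`, the leaf itself).  **Theorem** (`not_catalytic`, `not_catalytic_le`): for
`N, m ≥ 1` and every `k` this is false (`k = 0` is `not_tight`).

Proof.  Work with the pair-tensor form `P : (X; u, w) ↦ (Xu, Xᵀw)` of `C₁`, whose input slices
`S_ω` all kill `z ↦ sgn(z)·ω(z)` (`slice_mulVec_sgn`), and let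
`t = ⟨m⟩ ⊠ ⟨2,2,2⟩^{⊠N} ⊕ ⟨k⟩ ⊠ P^{⊠N} = (A, B, C)·⟨m+k⟩ ⊠ P^{⊠N}`.  Both sides have the same input
and the same output format and `t` is concise on both legs in slice form (`padded_weight_eq_zero`,
`padded_vec_eq_zero`), so slice transport `S^t_w = A·S_{Bᵀw}·Cᵀ` (`slice_restrict`) makes `Bᵀ`,
`Cᵀ` injective between spaces of equal dimension, hence invertible (`exists_two_sided_inv`).  Then
`G = C⁻ᵀ·diag(sgn)·Bᵀ` is invertible and `S^t_w · (G w) = 0` for EVERY weight `w`.  On the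
`⟨2,2,2⟩`-summand the slice at the identity pattern is `1` (`slice_tgt_idWeight`) and slices are
linear in `w`, so the weights `id ± u` give `(1 ± S_u)(±g_u) = 0`, whence `g_u = 0`: every
`⟨2,2,2⟩`-output row of `G` vanishes — impossible for an invertible `G` once `m ≥ 1`.  Equal
formats on BOTH vector legs are essential (`⟨3⟩ ⊠ C₁ ⊵ ⟨2⟩ ⊠ ⟨2,2,2⟩`, `OutsiderSandwichYield`).

## References
* D. Coppersmith, S. Winograd, *Matrix multiplication via arithmetic progressions*,
  J. Symbolic Comput. 9 (1990) 251–280, §7 (the coupled block). [CoppersmithWinograd1990]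
* P. Bürgisser, M. Clausen, M. A. Shokrollahi, *Algebraic Complexity Theory*, Springer (1997),
  §14.4 (restriction and slices; concise tensors). [BurgisserClausenShokrollahi1997]
* M. Christandl, P. Vrana, J. Zuiddam, *Universal points in the asymptotic spectrum of tensors*,
  J. Amer. Math. Soc. 36 (2023), §1.1 (direct sums, the semiring). [ChristandlVranaZuiddam2023]
-/

noncomputable section

open scoped BigOperators Matrix

set_option linter.dupNamespace false
set_option autoImplicit false

namespace Summit.MatrixMultiplication.MatrixMultiplication.Theorems.OutsiderSandwichNoCatalysis

open Literature.Computability.AlgebraicComplexity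
open Summit.MatrixMultiplication.MatrixMultiplication.Theorems.OutsiderSandwichCoupling (coupling₁)
open Summit.MatrixMultiplication.MatrixMultiplication.Theorems.OutsiderSandwichBlockNormalForm
  (pairTensor coupling₁_restrictsTo_pairTensor pairTensor_restrictsTo_coupling₁)
open Summit.MatrixMultiplication.MatrixMultiplication.Theorems.OutsiderSandwichAmortised
  (mk_unit_kronecker_pow)
open Summit.MatrixMultiplication.MatrixMultiplication.Theorems.OutsiderSandwichNoTightExchange
open Summit.MatrixMultiplication.MatrixMultiplication.Theorems.OutsiderSandwichSliceConcise

/-! ## No catalysis -/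

section Main

variable {N m k : ℕ}

/-- **No catalysis** (pair-tensor form): for `N, m ≥ 1` and every `k`, `⟨m+k⟩ ⊠ P^{⊠N}` does not
restrict to `⟨m⟩ ⊠ ⟨2,2,2⟩^{⊠N} ⊕ ⟨k⟩ ⊠ P^{⊠N}`. [cite: CoppersmithWinograd1990, §7] -/
theorem not_catalytic_src (hN : 1 ≤ N) (hm : 1 ≤ m) (k : ℕ) :
    ¬ TensorRestrictsTo (src N (m + k)) (directSumTensor (tgt N m) (src N k)) := by
  classical
  rintro ⟨A, B, C, hABC⟩
  -- transport of slices
  set Bt : Matrix (J N (m + k)) (J N m ⊕ J N k) ℂ := (Matrix.of B)ᵀ with hBt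
  set Ct : Matrix (J N (m + k)) (J N m ⊕ J N k) ℂ := (Matrix.of C)ᵀ with hCt
  have hw : ∀ w' : J N m ⊕ J N k → ℂ, (fun b => ∑ b', w' b' * B b' b) = Bt.mulVec w' := by
    intro w'; funext b
    simp only [hBt, Matrix.mulVec, dotProduct, Matrix.transpose_apply, Matrix.of_apply]
    exact Finset.sum_congr rfl fun b' _ => mul_comm _ _
  have key : ∀ w' : J N m ⊕ J N k → ℂ, slice (directSumTensor (tgt N m) (src N k)) w' =
      Matrix.of A * slice (src N (m + k)) (Bt.mulVec w') * Ct := by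
    intro w'
    rw [← hw w']
    exact slice_restrict A B C hABC w'
  -- `Cᵀ` and `Bᵀ` are invertible (conciseness + equal formats)
  have hCinj : ∀ ζ, Ct.mulVec ζ = 0 → ζ = 0 := by
    intro ζ hζ
    refine padded_vec_eq_zero fun w' => ?_
    rw [key w', ← Matrix.mulVec_mulVec, ← Matrix.mulVec_mulVec, hζ, Matrix.mulVec_zero,
      Matrix.mulVec_zero]
  obtain ⟨D, hCD, hDC⟩ := exists_two_sided_inv Ct (card_padded N m k) hCinj
  have hBinj : ∀ w', Bt.mulVec w' = 0 → w' = 0 := by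
    intro w' hw'
    refine padded_weight_eq_zero ?_
    rw [key w', hw', slice_zero, Matrix.mul_zero, Matrix.zero_mul]
  obtain ⟨E, hBE, -⟩ := exists_two_sided_inv Bt (card_padded N m k) hBinj
  -- the invertible annihilator `G = C⁻ᵀ · diag(sgn) · Bᵀ`
  set Sg : Matrix (J N (m + k)) (J N (m + k)) ℂ := Matrix.diagonal (sgn (m := m + k) hN) with hSg
  have hdiag : Sg * Sg = 1 := by
    rw [hSg, Matrix.diagonal_mul_diagonal, ← Matrix.diagonal_one]
    congr 1; funext z; exact sgn_mul_self hN z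
  set G : Matrix (J N m ⊕ J N k) (J N m ⊕ J N k) ℂ := D * Sg * Bt with hG
  have hGG : G * (E * Sg * Ct) = 1 := by
    calc G * (E * Sg * Ct) = D * (Sg * ((Bt * E) * (Sg * Ct))) := by
          simp only [hG, Matrix.mul_assoc]
      _ = 1 := by rw [hBE, Matrix.one_mul, ← Matrix.mul_assoc Sg Sg Ct, hdiag, Matrix.one_mul, hDC]
  have hann : ∀ w', (slice (directSumTensor (tgt N m) (src N k)) w').mulVec (G.mulVec w') = 0 := by
    intro w'
    have hκ : G.mulVec w' = D.mulVec (fun z => sgn hN z * Bt.mulVec w' z) := by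
      rw [hG, ← Matrix.mulVec_mulVec, ← Matrix.mulVec_mulVec]
      congr 1; funext z; rw [hSg]; exact Matrix.mulVec_diagonal _ _ z
    have hback : Ct.mulVec (D.mulVec fun z => sgn hN z * Bt.mulVec w' z) =
        fun z => sgn hN z * Bt.mulVec w' z := by
      rw [Matrix.mulVec_mulVec, hCD, Matrix.one_mulVec]
    rw [key w', hκ, ← Matrix.mulVec_mulVec, ← Matrix.mulVec_mulVec, hback, slice_mulVec_sgn hN,
      Matrix.mulVec_zero]
  -- the `⟨2,2,2⟩`-block: `S_{w₁} · (G (w₁, w₂))|_{⟨2,2,2⟩} = 0`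
  have hM : ∀ (w₁ : J N m → ℂ) (w₂ : J N k → ℂ),
      (slice (tgt N m) w₁).mulVec (G.mulVec (Sum.elim w₁ w₂) ∘ Sum.inl) = 0 := by
    intro w₁ w₂
    have e := hann (Sum.elim w₁ w₂)
    rw [slice_directSum, Matrix.fromBlocks_mulVec] at e
    funext a
    have ea := congrFun e (Sum.inl a)
    simp only [Sum.elim_inl, Sum.elim_inr, Pi.zero_apply, Matrix.zero_mulVec, add_zero] at ea
    exact ea
  have hlin : ∀ (w₁ w₁' : J N m → ℂ) (w₂ w₂' : J N k → ℂ),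
      G.mulVec (Sum.elim (w₁ + w₁') (w₂ + w₂')) ∘ Sum.inl =
        G.mulVec (Sum.elim w₁ w₂) ∘ Sum.inl + G.mulVec (Sum.elim w₁' w₂') ∘ Sum.inl := by
    intro w₁ w₁' w₂ w₂'
    rw [sum_elim_add, Matrix.mulVec_add]; rfl
  have hneg : ∀ (w₁ : J N m → ℂ) (w₂ : J N k → ℂ),
      G.mulVec (Sum.elim (-w₁) (-w₂)) ∘ Sum.inl = -(G.mulVec (Sum.elim w₁ w₂) ∘ Sum.inl) := by
    intro w₁ w₂
    rw [sum_elim_neg, Matrix.mulVec_neg]; rfl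
  -- at the identity pattern the slice is `1`
  have hid : ∀ w₂ : J N k → ℂ, G.mulVec (Sum.elim (idWeight N m) w₂) ∘ Sum.inl = 0 := by
    intro w₂
    simpa [slice_tgt_idWeight] using hM (idWeight N m) w₂
  have hzero : ∀ w₂ : J N k → ℂ, G.mulVec (Sum.elim 0 w₂) ∘ Sum.inl = 0 := by
    intro w₂
    have e := hlin (idWeight N m) 0 0 w₂
    rw [add_zero, zero_add, hid, hid, zero_add] at e
    exact e.symm
  have hu : ∀ u : J N m → ℂ, G.mulVec (Sum.elim u 0) ∘ Sum.inl = 0 := by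
    intro u
    -- weights `id + u` and `id - u`
    have hp := hM (idWeight N m + u) (0 + 0)
    rw [hlin, hid, zero_add, slice_add, slice_tgt_idWeight, Matrix.add_mulVec,
      Matrix.one_mulVec] at hp
    have hn := hM (idWeight N m + -u) (0 + -0)
    rw [hlin, hid, zero_add, hneg, slice_add, slice_neg, slice_tgt_idWeight, Matrix.add_mulVec,
      Matrix.one_mulVec, Matrix.neg_mulVec, Matrix.mulVec_neg, neg_neg] at hn
    -- `v + S v = 0` and `-v + S v = 0` give `S v = 0`, then `v = 0`
    have hS : (slice (tgt N m) u).mulVec (G.mulVec (Sum.elim u 0) ∘ Sum.inl) = 0 := by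
      have e := congrArg₂ (· + ·) hp hn
      rw [add_zero, add_add_add_comm, add_neg_cancel, zero_add, ← two_smul ℂ] at e
      exact (smul_eq_zero.mp e).resolve_left two_ne_zero
    rw [hS, add_zero] at hp
    exact hp
  -- every `⟨2,2,2⟩`-output row of `G` vanishes …
  let z₀ : J N m := (⟨0, hm⟩, fun _ => ((0 : Fin 2), (0 : Fin 2)))
  have hrow : ∀ w' : J N m ⊕ J N k → ℂ, G.mulVec w' (Sum.inl z₀) = 0 := by
    intro w'
    have hsplit : w' = Sum.elim (fun b => w' (Sum.inl b)) (0 : J N k → ℂ)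
        + Sum.elim (0 : J N m → ℂ) (fun b => w' (Sum.inr b)) := by
      funext x; rcases x with x | x <;> simp
    rw [hsplit, Matrix.mulVec_add, Pi.add_apply]
    have e1 := congrFun (hu fun b => w' (Sum.inl b)) z₀
    have e2 := congrFun (hzero fun b => w' (Sum.inr b)) z₀
    simp only [Function.comp_apply, Pi.zero_apply] at e1 e2
    rw [e1, e2, add_zero]
  -- … but `G` is invertible
  have h1 := congrFun (congrFun hGG (Sum.inl z₀)) (Sum.inl z₀)
  rw [Matrix.one_apply_eq, Matrix.mul_apply] at h1
  have h0 := hrow fun x => (E * Sg * Ct) x (Sum.inl z₀)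
  simp only [Matrix.mulVec, dotProduct] at h0
  rw [h0] at h1
  exact zero_ne_one h1

/-- **No catalysis** (semiring form): for `N, m ≥ 1` and every `k`,
`m·[⟨2,2,2⟩]^N + k·[C₁]^N ≰ (m+k)·[C₁]^N` in `T(ℂ)` — `k` coupled blocks handed back do not help to
convert `m` more. [cite: CoppersmithWinograd1990, §7] -/
theorem not_catalytic_le (hN : 1 ≤ N) (hm : 1 ≤ m) (k : ℕ) :
    ¬ ((m : TensorClass ℂ) * TensorClass.mk (matMulTensor ℂ 2 2 2) ^ N
        + (k : TensorClass ℂ) * TensorClass.mk coupling₁ ^ N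
        ≤ ((m + k : ℕ) : TensorClass ℂ) * TensorClass.mk coupling₁ ^ N) := by
  classical
  intro h
  have hC : TensorClass.mk coupling₁ = TensorClass.mk (pairTensor 2) :=
    le_antisymm (TensorClass.mk_le_mk_iff.2 pairTensor_restrictsTo_coupling₁)
      (TensorClass.mk_le_mk_iff.2 coupling₁_restrictsTo_pairTensor)
  rw [hC, ← mk_unit_kronecker_pow (matMulTensor ℂ 2 2 2) m N,
    ← mk_unit_kronecker_pow (pairTensor 2) k N, ← mk_unit_kronecker_pow (pairTensor 2) (m + k) N,
    TensorClass.mk_add_mk, TensorClass.mk_le_mk_iff] at h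
  exact not_catalytic_src hN hm k h

/-- **No catalysis**: for `N, m ≥ 1` and every `k`, `⟨m+k⟩ ⊠ C₁^{⊠N}` does not restrict to
`⟨m⟩ ⊠ ⟨2,2,2⟩^{⊠N} ⊕ ⟨k⟩ ⊠ C₁^{⊠N}` (`k = 0`: `OutsiderSandwichNoTightExchange.not_tight`).
[cite: CoppersmithWinograd1990, §7] -/
theorem not_catalytic (hN : 1 ≤ N) (hm : 1 ≤ m) (k : ℕ) :
    ¬ TensorRestrictsTo (kroneckerTensor (unitTensor ℂ (m + k)) (kroneckerPow coupling₁ N))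
        (directSumTensor (kroneckerTensor (unitTensor ℂ m) (kroneckerPow (matMulTensor ℂ 2 2 2) N))
          (kroneckerTensor (unitTensor ℂ k) (kroneckerPow coupling₁ N))) := by
  classical
  intro h
  apply not_catalytic_le hN hm k
  have h' := TensorClass.mk_le_mk_iff.2 h
  rwa [← TensorClass.mk_add_mk, mk_unit_kronecker_pow, mk_unit_kronecker_pow,
    mk_unit_kronecker_pow] at h'

/-- **No catalytic exchange for one product**, in the semiring:
`[⟨2,2,2⟩]^N + k·[C₁]^N ≰ (k+1)·[C₁]^N`. [cite: CoppersmithWinograd1990, §7] -/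
theorem not_catalytic_one (hN : 1 ≤ N) (k : ℕ) :
    ¬ (TensorClass.mk (matMulTensor ℂ 2 2 2) ^ N
        + (k : TensorClass ℂ) * TensorClass.mk coupling₁ ^ N
        ≤ ((k + 1 : ℕ) : TensorClass ℂ) * TensorClass.mk coupling₁ ^ N) := by
  have h := not_catalytic_le hN (le_refl 1) k
  rwa [Nat.cast_one, one_mul, Nat.add_comm] at h

end Main

end Summit.MatrixMultiplication.MatrixMultiplication.Theorems.OutsiderSandwichNoCatalysis
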